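import Mathlib.LinearAlgebra.Lagrange
import Mathlib.Algebra.MvPolynomial.Funext
import Mathlib.Algebra.MvPolynomial.Monad
import HarnessLib

/-!
# Interpolating sets for the GKSS reconstruction: tensor Lagrange extraction on a shifted grid,
# and existence of a shift on which a nonzero polynomial vanishes nowhere on the grid

Cell `val-lit`, seat t19 (literature-prover); groundwork for the discharge programme of
`GKSS2019_mainThm` (v2, erratum A34) along the printed proof of [GKSS19, §3]. One bookkeeping
definition (`nodalDual`, the dual Lagrange coefficients of an arbitrary node vector — the tree's
`vandermondeDual` of `CoefficientExtraction.lean` is the special case of the nodes `0, …, d`) and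
THEOREMS; no named facts; nothing here bears on `VP ≠ VNP`, which is NOT proved.

Source: Z. Guo, M. Kumar, R. Saptharishi, N. Solomon, *Derandomization from algebraic hardness*,
SIAM J. Comput. 51 (2022) = arXiv:1905.00091 [GuoKumarSaptharishiSolomon2019]: Def. 15–16 and
Prop. 17 (interpolating sets for degree-`m` forms; held text `paper:arxiv-1905.00091`,
p0009.txt:L28–L48) and their use in §3 ("an interpolating set w.r.t. `y` … as long as
`Ψ(a) ≠ 0`. Since `Ψ(y)` is a nonzero polynomial … explicit interpolating sets (Proposition 17)
can be found", p0011.txt:L77–L82, p0012.txt:L1–L4).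

## What is here

The reconstruction (§3) needs, for the degree-`m` `y`-forms `Δ_m(P_{m+j})(z, y)`, a set of points
`a` avoiding the hypersurface `Ψ = 0` from whose values the coefficients are fixed linear
combinations. Instead of Prop. 17's hitting-set-based sets we use a SHIFTED GRID
`v + {0, …, d}^n` (any `v`), which is interpolating for all polynomials of individual degree
`≤ d` by tensor-product Lagrange interpolation, and choose the shift `v` off the finitely many
translates of `Ψ = 0` (possible over an infinite field):

* `nodalDual w j a` — coefficient of `t^j` in the Lagrange basis polynomial of node `a` for an
  arbitrary node vector `w : Fin (d+1) → F`; `sum_nodalDual_mul_pow` — duality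
  `Σ_a λ_{j,a} w_a^e = [j = e]` (`e ≤ d`, `w` injective);
* `coeff_eq_sum_smul_eval_nodes` — for `P ∈ R[x_1..x_n]` over a commutative `F`-algebra `R`
  with exponents `≤ d` and per-coordinate injective nodes `w_i : Fin (d+1) → F`:
  `coeff_m P = Σ_{α ∈ Fin (d+1)^n} (∏_i λ^{(w_i)}_{m_i, α_i}) • P(w_1(α_1), …, w_n(α_n))`;
* `exists_shift_forall_grid_eval_ne_zero` — `F` infinite, `Ψ ≠ 0`: there is `v ∈ F^σ` with
  `Ψ(v + α) ≠ 0` for every `α ∈ {0, …, d}^σ`.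

## References
* [GuoKumarSaptharishiSolomon2019] arXiv:1905.00091, Def. 15–16, Prop. 17 (p0009.txt:L28–48);
  §3 (p0011.txt:L77–82, p0012.txt:L1–4).
* [Burgisser2000] §2.1 (interpolation arguments; tree `CoefficientExtraction.lean`, whose proofs
  of `sum_vandermondeDual_mul_pow` / `coeff_eq_sum_smul_eval` are followed here verbatim with
  general nodes).
-/

noncomputable section

namespace Literature.Computability.AlgebraicComplexity

open MvPolynomial Finset

/-! ### Dual Lagrange coefficients of an arbitrary node vector -/

section Dual

variable {F : Type*} [Field F] {d : ℕ}

/-- The dual Lagrange coefficient `λ^{(w)}_{j,a}`: the coefficient of `t^j` in the Lagrange basis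
polynomial of the node `a` for the node vector `w : Fin (d+1) → F` (GKSS Def. 15: "an
interpolating set … for every `β`, `Σ_i β_i · f(a_i, b_i)` equals the coefficient"; here the
explicit coefficients for a grid). [cite: GuoKumarSaptharishiSolomon2019, Def. 15 (arXiv p0009.txt:L28-33)] -/
def nodalDual (w : Fin (d + 1) → F) (j : ℕ) (a : Fin (d + 1)) : F :=
  (Lagrange.basis (Finset.univ : Finset (Fin (d + 1))) w a).coeff j

/-- Unfolding lemma. [cite: GuoKumarSaptharishiSolomon2019, Def. 15 (arXiv p0009.txt:L28-33)] -/
theorem nodalDual_def (w : Fin (d + 1) → F) (j : ℕ) (a : Fin (d + 1)) :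
    nodalDual w j a = (Lagrange.basis (Finset.univ : Finset (Fin (d + 1))) w a).coeff j := rfl

/-- **Duality**: `Σ_a λ^{(w)}_{j,a} w_a^e = [j = e]` for `e ≤ d` and distinct nodes (the
`t^j`-coefficients of the Lagrange identity `t^e = Σ_a w_a^e ℓ_a(t)`).
[cite: GuoKumarSaptharishiSolomon2019, Def. 15 (arXiv p0009.txt:L28-33)] -/
theorem sum_nodalDual_mul_pow {w : Fin (d + 1) → F} (hw : Function.Injective w) {e : ℕ}
    (he : e ≤ d) (j : ℕ) :
    ∑ a : Fin (d + 1), nodalDual w j a * w a ^ e = if j = e then 1 else 0 := by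
  have hdeg : ((Polynomial.X : Polynomial F) ^ e).degree <
      (Finset.univ : Finset (Fin (d + 1))).card := by
    rw [Polynomial.degree_X_pow, Finset.card_univ, Fintype.card_fin]
    exact_mod_cast Nat.lt_succ_of_le he
  have h := Lagrange.eq_interpolate (v := w) (s := Finset.univ) hw.injOn hdeg
  have hc := congrArg (fun q : Polynomial F => q.coeff j) h
  simp only [Polynomial.coeff_X_pow, Lagrange.interpolate_apply, Polynomial.finsetSum_coeff,
    Polynomial.coeff_C_mul, Polynomial.eval_pow, Polynomial.eval_X] at hc
  rw [hc]
  refine Finset.sum_congr rfl fun a _ => ?_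
  rw [nodalDual, mul_comm]

end Dual

/-! ### Tensor Lagrange extraction with per-coordinate nodes -/

section Identity

variable {F : Type*} [Field F] {R : Type*} [CommRing R] [Algebra F R] {n d : ℕ}

/-- Tensor duality: `Σ_α (∏_i λ^{(w_i)}_{m_i, α_i}) ∏_i w_i(α_i)^{s_i} = [m = s]` for exponents
`s_i ≤ d`. [cite: GuoKumarSaptharishiSolomon2019, Def. 15-16 (arXiv p0009.txt:L28-40)] -/
theorem sum_prod_nodalDual_mul_prod_pow {w : Fin n → Fin (d + 1) → F}
    (hw : ∀ i, Function.Injective (w i)) (m s : Fin n →₀ ℕ) (hs : ∀ i, s i ≤ d) :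
    ∑ α : Fin n → Fin (d + 1), (∏ i, nodalDual (w i) (m i) (α i)) * ∏ i, w i (α i) ^ s i =
      if m = s then 1 else 0 := by
  classical
  have h1 : ∀ α : Fin n → Fin (d + 1),
      (∏ i, nodalDual (w i) (m i) (α i)) * ∏ i, w i (α i) ^ s i =
        ∏ i, (nodalDual (w i) (m i) (α i) * w i (α i) ^ s i) := fun α =>
    (Finset.prod_mul_distrib).symm
  simp_rw [h1]
  rw [← Fintype.prod_sum (fun i (a : Fin (d + 1)) => nodalDual (w i) (m i) a * w i a ^ s i)]
  have h2 : ∀ i : Fin n, ∑ a : Fin (d + 1), nodalDual (w i) (m i) a * w i a ^ s i =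
      if m i = s i then 1 else 0 := fun i => sum_nodalDual_mul_pow (hw i) (hs i) (m i)
  simp_rw [h2]
  by_cases hms : m = s
  · subst hms; simp
  · rw [if_neg hms]
    obtain ⟨i, hi⟩ : ∃ i, m i ≠ s i := by
      by_contra hcon
      simp only [not_exists, not_not] at hcon
      exact hms (Finsupp.ext hcon)
    exact Finset.prod_eq_zero (Finset.mem_univ i) (if_neg hi)

/-- **Coefficient extraction on a grid with arbitrary per-coordinate nodes** over a commutative
`F`-algebra `R`: for `P ∈ R[x_1..x_n]` with all exponents `≤ d` and injective node vectors
`w_i : Fin (d+1) → F`,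
`[x^m] P = Σ_{α} (∏_i λ^{(w_i)}_{m_i,α_i}) • P(w_1(α_1), …, w_n(α_n))` ("for every `β` …
`Σ_i β_i f(a_i)` equals the coefficient", with explicit `β`).
[cite: GuoKumarSaptharishiSolomon2019, Def. 15-16 (arXiv p0009.txt:L28-40)] -/
theorem coeff_eq_sum_smul_eval_nodes (P : MvPolynomial (Fin n) R)
    (hd : ∀ s ∈ P.support, ∀ i, s i ≤ d) {w : Fin n → Fin (d + 1) → F}
    (hw : ∀ i, Function.Injective (w i)) (m : Fin n →₀ ℕ) :
    coeff m P = ∑ α : Fin n → Fin (d + 1),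
      (∏ i, nodalDual (w i) (m i) (α i)) • eval (fun i => algebraMap F R (w i (α i))) P := by
  classical
  simp_rw [eval_eq' _ P, Finset.smul_sum, Algebra.smul_def, map_prod]
  rw [Finset.sum_comm]
  have key : ∀ s ∈ P.support,
      ∑ α : Fin n → Fin (d + 1), (∏ i, algebraMap F R (nodalDual (w i) (m i) (α i))) *
        (coeff s P * ∏ i, (algebraMap F R (w i (α i))) ^ s i) =
      coeff s P * algebraMap F R (if m = s then 1 else 0) := by
    intro s hs
    rw [← sum_prod_nodalDual_mul_prod_pow hw m s (hd s hs), map_sum, Finset.mul_sum]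
    refine Finset.sum_congr rfl fun α _ => ?_
    rw [map_mul, map_prod, map_prod]
    simp only [map_pow]
    ring
  rw [Finset.sum_congr rfl key]
  simp_rw [apply_ite (algebraMap F R), map_one, map_zero, mul_ite, mul_one, mul_zero]
  rw [Finset.sum_ite_eq]
  split_ifs with h
  · rfl
  · exact (notMem_support_iff.1 h)

end Identity

/-! ### A shift of the grid avoiding `Ψ = 0` -/

namespace GKSS2019

variable {F : Type*} [Field F] {σ : Type*}

/-- Translation `x ↦ x + c` is injective on polynomials. [cite: GuoKumarSaptharishiSolomon2019, §3 (arXiv p0011.txt:L77-82)] -/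
theorem aeval_X_add_C_ne_zero (c : σ → F) {Ψ : MvPolynomial σ F} (hΨ : Ψ ≠ 0) :
    aeval (fun i => X i + C (c i)) Ψ ≠ 0 := by
  intro h
  apply hΨ
  have hcomp : ∀ p : MvPolynomial σ F,
      aeval (fun i => X i - C (c i)) (aeval (fun i => X i + C (c i)) p) = p := by
    intro p
    rw [← AlgHom.comp_apply, comp_aeval]
    have : (fun i => (aeval fun i => X i - C (c i)) (X i + C (c i) : MvPolynomial σ F)) = X := by
      funext i
      simp
    rw [this, aeval_X_left, AlgHom.id_apply]
  rw [← hcomp Ψ, h, map_zero]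

/-- Evaluating a translate: `Ψ(x + c)` at `v` is `Ψ` at `v + c`. [cite: GuoKumarSaptharishiSolomon2019, §3 (arXiv p0011.txt:L77-82)] -/
theorem eval_aeval_X_add_C (c v : σ → F) (Ψ : MvPolynomial σ F) :
    eval v (aeval (fun i => X i + C (c i)) Ψ) = eval (fun i => v i + c i) Ψ := by
  rw [aeval_eq_bind₁, show eval v (bind₁ (fun i => X i + C (c i)) Ψ) =
    eval₂Hom (RingHom.id F) v (bind₁ (fun i => X i + C (c i)) Ψ) from rfl, eval₂Hom_bind₁]
  simp only [eval₂Hom_X', eval₂Hom_C, map_add, RingHom.id_apply]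
  rfl

/-- **Good shifted grids exist.** Over an infinite field, for `Ψ ≠ 0` and any `d` there is a shift
`v ∈ F^σ` such that `Ψ(v + α) ≠ 0` for every grid point `α ∈ {0, …, d}^σ` ("Since `Ψ(y)` is a
nonzero polynomial … of degree `< D'`, explicit … sets containing such a point `a`"; here all
`(d+1)^{|σ|}` points of the shifted grid avoid `Ψ = 0` at once).
[cite: GuoKumarSaptharishiSolomon2019, §3 (arXiv p0011.txt:L77-82, p0012.txt:L1-4)] -/
theorem exists_shift_forall_grid_eval_ne_zero [Infinite F] [Fintype σ] [DecidableEq σ]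
    (Ψ : MvPolynomial σ F) (hΨ : Ψ ≠ 0) (d : ℕ) :
    ∃ v : σ → F, ∀ α : σ → Fin (d + 1), eval (fun i => v i + ((α i : ℕ) : F)) Ψ ≠ 0 := by
  classical
  set Γ : MvPolynomial σ F :=
    ∏ α : σ → Fin (d + 1), aeval (fun i => X i + C ((α i : ℕ) : F)) Ψ with hΓ
  have hΓne : Γ ≠ 0 :=
    Finset.prod_ne_zero_iff.mpr fun α _ => aeval_X_add_C_ne_zero _ hΨ
  have hex : ∃ v : σ → F, eval v Γ ≠ 0 := by
    by_contra hcon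
    simp only [not_exists, not_not] at hcon
    exact hΓne (MvPolynomial.funext fun v => by rw [hcon v, map_zero])
  obtain ⟨v, hv⟩ := hex
  refine ⟨v, fun α => ?_⟩
  rw [hΓ, map_prod] at hv
  have := (Finset.prod_ne_zero_iff.mp hv) α (Finset.mem_univ α)
  rwa [eval_aeval_X_add_C] at this

end GKSS2019

end Literature.Computability.AlgebraicComplexity
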